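import Summits.CriticalPhenomena.CardyFormulaZ2.Theses.CardyBoundaryCoulombGas
import Summits.CriticalPhenomena.CardyFormulaZ2.Theorems.CardyBoundaryCoulombGasStripClusterRatesIterateAverage
import Literature.Probability.LatticeModels.RowStatePlanar
import Literature.Probability.Percolation.LatticeSymmetry

/-!
# Stub `relaxationLower` (S2b) of line `two-cluster-rate-is-stationary-gap`, crux `StripClusterRates`

For the planar `⋆`-chain `planarTransfer S`, `S = Finset.Icc 0 n` (one column of bond percolation on
`ℤ²` at `p = 1/2`, `Literature/Probability/LatticeModels/RowStatePlanar.lean`), every eigenpair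
`(μ, v)` of the UNMARKED block (patterns in which no site is joined to `⋆`; `v` vanishes on marked
patterns and the eigen-equation holds on unmarked rows) with `μ ≠ 1` is seen by the monotone grand
coupling: `c ‖μ‖ ^ m ≤ DIS(n, m)`, where `DIS(n, m)` is the fraction of admissible bond sequences of
length `m` on which the iterates from ALLJOINED (all sites one class, `⋆` apart) and from FREE differ.

Proof (elementary; [LevinPeresWilmer2009 §12.2, Prop. 4.7/§5 (grand coupling)] for the idea):
* one step of the chain is the uniform average over the `2^|S| · 2^|hEdges S|` bond configurations of
  the deterministic steps `planarRowStep O H` (`s2b_sum_planarTransfer_mul`, complex-valued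
  observables), unmarked patterns stay unmarked (`s1_rowStep_not_joinedToStar` of the line's landed
  helper `…StripClusterRatesIterateAverage`, whose word bookkeeping `s1_sum_piFinset_succ`,
  `s1_foldl_ofFn_cons` is reused), hence the ITERATED eigen-equation in counting form
  `μ ^ m v p = (∑_{seq} v (iterate seq p)) / total ^ m` for unmarked `p` (`s2b_pow_mul_eq_sum_iter`);
* `μ ≠ 1` forces `v` to be non-constant on unmarked patterns (rows of the block sum to `1`);
* `rowStep O H` is monotone for the refinement order of partitions (`vertRel_mono`, `⊔`), FREE is
  the bottom and every unmarked pattern lies below ALLJOINED (`s2b_rel_le_alljoined`), so on a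
  sequence where the iterates from ALLJOINED and FREE agree, the iterates from ANY two unmarked
  patterns agree (squeeze + antisymmetry); on the other sequences the difference of `v`-values is at
  most `2 ∑ ‖v‖`. Summing: `‖μ‖^m ‖v a - v b‖ ≤ 2 (∑‖v‖) · DIS(n, m)` (`s2b_coupling_bound`).
No difference-of-monotone-functions decomposition is needed for this lower bound.
-/

noncomputable section

namespace Summit.CriticalPhenomena.CardyFormulaZ2.Cruxes.StripClusterRates.TwoClusterRateIsStationaryGap

open Filter Topology
open scoped BigOperators Classical
open Literature.Probability.Percolation Literature.Probability.LatticeModels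

/-! ## One step of the planar chain as an average of deterministic steps -/

/-- **One-step average.** `∑_q T p q · g q` is the uniform average of `g (planarRowStep O H p)` over
the bond configurations `(O, H) ∈ univ ×ˢ (hEdges S).powerset` (definition of
`PercolationRowTransfer` as a normalised count, summed fiberwise). -/
theorem s2b_sum_planarTransfer_mul (S : Finset ℤ) (p : PlanarRowState S) (g : PlanarRowState S → ℂ) :
    ∑ q, (planarTransfer S p q : ℂ) * g q =
      (∑ OH ∈ (Finset.univ : Finset (Finset S)) ×ˢ (hEdges S).powerset,
          g (planarRowStep OH.1 OH.2 p)) / ((2 : ℂ) ^ S.card * 2 ^ (hEdges S).card) := by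
  have hN : ((2 : ℂ) ^ S.card * 2 ^ (hEdges S).card) ≠ 0 :=
    mul_ne_zero (pow_ne_zero _ two_ne_zero) (pow_ne_zero _ two_ne_zero)
  rw [eq_div_iff hN, Finset.sum_mul,
    ← Finset.sum_fiberwise' ((Finset.univ : Finset (Finset S)) ×ˢ (hEdges S).powerset)
      (fun OH => planarRowStep OH.1 OH.2 p) g]
  refine Finset.sum_congr rfl fun q _ => ?_
  rw [Finset.sum_const, nsmul_eq_mul]
  have hfilter :
      ((Finset.univ : Finset (Finset S)) ×ˢ (hEdges S).powerset).filter
          (fun OH => rowStep OH.1 OH.2 p.1 = q.1) =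
        ((Finset.univ : Finset (Finset S)) ×ˢ (hEdges S).powerset).filter
          (fun OH => planarRowStep OH.1 OH.2 p = q) :=
    Finset.filter_congr fun OH _ => ⟨fun h => Subtype.ext h, fun h => congrArg Subtype.val h⟩
  unfold planarTransfer PercolationRowTransfer
  rw [hfilter]
  push_cast
  rw [div_mul_eq_mul_div, div_mul_cancel₀ _ hN]

/-! ## The iterated eigen-equation in counting form -/

/-- **Iterated eigen-equation, counting form.** If `v` satisfies the one-step eigen-equation on
unmarked rows, then for every unmarked `p` and every `m`,
`μ ^ m · v p = (∑_{admissible seq} v (iterate seq p)) / total ^ m`. -/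
theorem s2b_pow_mul_eq_sum_iter (S : Finset ℤ) (μ : ℂ) (v : PlanarRowState S → ℂ)
    (heig : ∀ p : PlanarRowState S, (∀ x, ¬ p.1.JoinedToStar x) →
      ∑ q, (planarTransfer S p q : ℂ) * v q = μ * v p)
    (m : ℕ) (p : PlanarRowState S) (hp : ∀ x, ¬ p.1.JoinedToStar x) :
    μ ^ m * v p =
      (∑ seq ∈ Fintype.piFinset
          (fun _ : Fin m => (Finset.univ : Finset (Finset S)) ×ˢ (hEdges S).powerset),
          v ((List.ofFn seq).foldl (fun r OH => planarRowStep OH.1 OH.2 r) p)) /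
        ((2 : ℂ) ^ S.card * 2 ^ (hEdges S).card) ^ m := by
  induction m generalizing p with
  | zero => simp [Fintype.piFinset_of_isEmpty]
  | succ m ih =>
    set A := (Finset.univ : Finset (Finset S)) ×ˢ (hEdges S).powerset
    set N := ((2 : ℂ) ^ S.card * 2 ^ (hEdges S).card)
    calc μ ^ (m + 1) * v p = μ ^ m * (μ * v p) := by ring
      _ = μ ^ m * ((∑ OH ∈ A, v (planarRowStep OH.1 OH.2 p)) / N) := by
          rw [← heig p hp, s2b_sum_planarTransfer_mul]
      _ = (∑ OH ∈ A, μ ^ m * v (planarRowStep OH.1 OH.2 p)) / N := by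
          rw [mul_div_assoc', Finset.mul_sum]
      _ = (∑ OH ∈ A, (∑ seq ∈ Fintype.piFinset (fun _ : Fin m => A),
            v ((List.ofFn seq).foldl (fun r OH => planarRowStep OH.1 OH.2 r)
              (planarRowStep OH.1 OH.2 p))) / N ^ m) / N := by
          congr 1
          refine Finset.sum_congr rfl fun OH _ => ih _ ?_
          exact s1_rowStep_not_joinedToStar OH.1 OH.2 p.1 hp
      _ = (∑ OH ∈ A, ∑ seq ∈ Fintype.piFinset (fun _ : Fin m => A),
            v ((List.ofFn seq).foldl (fun r OH => planarRowStep OH.1 OH.2 r)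
              (planarRowStep OH.1 OH.2 p))) / N ^ (m + 1) := by
          rw [← Finset.sum_div, div_div, ← pow_succ]
      _ = _ := by
          rw [s1_sum_piFinset_succ]
          simp only [s1_foldl_ofFn_cons]

/-! ## Monotone grand coupling -/

/-- In ALLJOINED `= rowStep univ (hEdges S) free` over an order-convex column set `S` (e.g.
`Finset.Icc 0 n`), all sites are in one class (consecutive columns are joined by the open horizontal
edges). -/
theorem s2b_alljoined_rel {S : Finset ℤ}
    (hS : ∀ x ∈ S, ∀ y ∈ S, ∀ z : ℤ, x ≤ z → z ≤ y → z ∈ S) (x y : S) :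
    (rowStep Finset.univ (hEdges S) (RowState.free S)).rel (Sum.inl x) (Sum.inl y) := by
  have hle : (hEdges S).sup hEdgeRel ≤ (rowStep Finset.univ (hEdges S) (RowState.free S)).rel :=
    le_sup_right
  have hstep : ∀ (z : S) (hz : (z : ℤ) + 1 ∈ S),
      (hEdges S).sup hEdgeRel (Sum.inl z) (Sum.inl ⟨(z : ℤ) + 1, hz⟩) := fun z hz =>
    (Finset.le_sup ((mem_hEdges z).2 hz) : hEdgeRel z ≤ (hEdges S).sup hEdgeRel) (hEdgeRel_rel z hz)
  have hup : ∀ (a : ℤ) (ha : a ∈ S) (b : ℤ), a ≤ b → ∀ hb : b ∈ S,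
      (hEdges S).sup hEdgeRel (Sum.inl ⟨a, ha⟩) (Sum.inl ⟨b, hb⟩) := by
    intro a ha b hab
    induction b, hab using Int.leInduction with
    | base => intro hb; exact Setoid.refl' _ _
    | succ b hab ih =>
      intro hb1
      have hb : b ∈ S := hS a ha (b + 1) hb1 b hab (by omega)
      exact Setoid.trans' _ (ih hb) (hstep ⟨b, hb⟩ hb1)
  apply hle
  rcases le_total (x : ℤ) y with h | h
  · exact hup x x.2 y h y.2
  · exact Setoid.symm' _ (hup y y.2 x h x.2)

/-- Every UNMARKED pattern on `S = Finset.Icc 0 n` lies below ALLJOINED in the refinement order. -/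
theorem s2b_rel_le_alljoined (n : ℕ) (p : PlanarRowState (Finset.Icc (0 : ℤ) n))
    (hp : ∀ x, ¬ p.1.JoinedToStar x) :
    p.1.rel ≤ (planarRowStep Finset.univ (hEdges (Finset.Icc (0 : ℤ) n))
      ⟨RowState.free (Finset.Icc (0 : ℤ) n), RowState.isPlanar_free (Finset.Icc (0 : ℤ) n)⟩).1.rel := by
  have hconvex : ∀ x ∈ Finset.Icc (0 : ℤ) n, ∀ y ∈ Finset.Icc (0 : ℤ) n, ∀ z : ℤ,
      x ≤ z → z ≤ y → z ∈ Finset.Icc (0 : ℤ) n := by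
    intro x hx y hy z hxz hzy
    rw [Finset.mem_Icc] at hx hy ⊢
    omega
  intro a b hab
  rcases a with x | u <;> rcases b with y | w
  · exact s2b_alljoined_rel hconvex x y
  · exact absurd hab (hp x)
  · exact absurd (p.1.rel.symm' hab) (hp y)
  · exact Setoid.refl' _ _

/-- **Coupling bound.** For an eigenpair of the unmarked block and unmarked `a`, `b` squeezed between
`bot` and `top` in the refinement order, `‖μ‖^m ‖v a - v b‖ · total^m ≤ 2 (∑‖v‖) · #{seq : the
iterates of seq from top and from bot differ}`. -/
theorem s2b_coupling_bound (S : Finset ℤ) (μ : ℂ) (v : PlanarRowState S → ℂ)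
    (heig : ∀ p : PlanarRowState S, (∀ x, ¬ p.1.JoinedToStar x) →
      ∑ q, (planarTransfer S p q : ℂ) * v q = μ * v p)
    (bot top a b : PlanarRowState S)
    (ha : ∀ x, ¬ a.1.JoinedToStar x) (hb : ∀ x, ¬ b.1.JoinedToStar x)
    (hba : bot.1.rel ≤ a.1.rel) (hat : a.1.rel ≤ top.1.rel)
    (hbb : bot.1.rel ≤ b.1.rel) (hbt : b.1.rel ≤ top.1.rel) (m : ℕ) :
    ‖μ‖ ^ m * ‖v a - v b‖ * ((2 : ℝ) ^ S.card * 2 ^ (hEdges S).card) ^ m ≤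
      2 * (∑ q, ‖v q‖) *
        (((Fintype.piFinset
            (fun _ : Fin m => (Finset.univ : Finset (Finset S)) ×ˢ (hEdges S).powerset)).filter
          fun seq => (List.ofFn seq).foldl (fun r OH => planarRowStep OH.1 OH.2 r) top ≠
            (List.ofFn seq).foldl (fun r OH => planarRowStep OH.1 OH.2 r) bot).card : ℝ) := by
  set N : ℝ := (2 : ℝ) ^ S.card * 2 ^ (hEdges S).card with hN
  set P := Fintype.piFinset
    (fun _ : Fin m => (Finset.univ : Finset (Finset S)) ×ˢ (hEdges S).powerset)
  -- the same-bonds coupling is monotone for refinement of partitions (`vertRel_mono`; the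
  -- horizontal layer is `· ⊔ const`)
  have hmono : ∀ (l : List (Finset S × Finset S)) (p q : PlanarRowState S), p.1.rel ≤ q.1.rel →
      (l.foldl (fun r OH => planarRowStep OH.1 OH.2 r) p).1.rel ≤
        (l.foldl (fun r OH => planarRowStep OH.1 OH.2 r) q).1.rel := by
    intro l
    induction l with
    | nil => intro p q h; exact h
    | cons OH l ih => intro p q h; exact ih _ _ (sup_le_sup_right (vertRel_mono OH.1 h) _)
  have hNpos : 0 < N := by positivity
  have hNc : ((2 : ℂ) ^ S.card * 2 ^ (hEdges S).card) = (N : ℂ) := by rw [hN]; push_cast; ring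
  have hFa := s2b_pow_mul_eq_sum_iter S μ v heig m a ha
  have hFb := s2b_pow_mul_eq_sum_iter S μ v heig m b hb
  rw [hNc] at hFa hFb
  have hdiff : μ ^ m * (v a - v b) =
      (∑ seq ∈ P, (v ((List.ofFn seq).foldl (fun r OH => planarRowStep OH.1 OH.2 r) a) -
        v ((List.ofFn seq).foldl (fun r OH => planarRowStep OH.1 OH.2 r) b))) / (N : ℂ) ^ m := by
    rw [mul_sub, hFa, hFb, Finset.sum_sub_distrib, sub_div]
  have hnorm : ‖μ‖ ^ m * ‖v a - v b‖ * N ^ m =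
      ‖∑ seq ∈ P, (v ((List.ofFn seq).foldl (fun r OH => planarRowStep OH.1 OH.2 r) a) -
        v ((List.ofFn seq).foldl (fun r OH => planarRowStep OH.1 OH.2 r) b))‖ := by
    have h := congrArg norm hdiff
    rw [norm_mul, norm_pow, norm_div, norm_pow, Complex.norm_real, Real.norm_of_nonneg hNpos.le] at h
    rw [h, div_mul_cancel₀ _ (pow_ne_zero _ hNpos.ne')]
  rw [hnorm]
  refine (norm_sum_le _ _).trans ?_
  have hM : ∀ q, ‖v q‖ ≤ ∑ q, ‖v q‖ := fun q =>
    Finset.single_le_sum (f := fun q => ‖v q‖) (fun q _ => norm_nonneg _) (Finset.mem_univ q)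
  have hterm : ∀ seq ∈ P,
      ‖v ((List.ofFn seq).foldl (fun r OH => planarRowStep OH.1 OH.2 r) a) -
        v ((List.ofFn seq).foldl (fun r OH => planarRowStep OH.1 OH.2 r) b)‖ ≤
      2 * (∑ q, ‖v q‖) *
        (if (List.ofFn seq).foldl (fun r OH => planarRowStep OH.1 OH.2 r) top ≠
            (List.ofFn seq).foldl (fun r OH => planarRowStep OH.1 OH.2 r) bot then 1 else 0) := by
    intro seq _
    split_ifs with hD
    · rw [mul_one]
      exact (norm_sub_le _ _).trans (by linarith [hM ((List.ofFn seq).foldl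
        (fun r OH => planarRowStep OH.1 OH.2 r) a), hM ((List.ofFn seq).foldl
        (fun r OH => planarRowStep OH.1 OH.2 r) b)])
    · rw [not_ne_iff] at hD
      have hEa : (List.ofFn seq).foldl (fun r OH => planarRowStep OH.1 OH.2 r) a =
          (List.ofFn seq).foldl (fun r OH => planarRowStep OH.1 OH.2 r) bot :=
        Subtype.ext (RowState.ext (le_antisymm (hD ▸ hmono _ _ _ hat) (hmono _ _ _ hba)))
      have hEb : (List.ofFn seq).foldl (fun r OH => planarRowStep OH.1 OH.2 r) b =
          (List.ofFn seq).foldl (fun r OH => planarRowStep OH.1 OH.2 r) bot :=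
        Subtype.ext (RowState.ext (le_antisymm (hD ▸ hmono _ _ _ hbt) (hmono _ _ _ hbb)))
      rw [hEa, hEb, sub_self, norm_zero, mul_zero]
  refine (Finset.sum_le_sum hterm).trans ?_
  rw [← Finset.mul_sum, Finset.sum_boole]

/-! ## The registered stub -/

/-- **S2b** `= RelaxationLower`: every eigenvalue `μ ≠ 1` of the unmarked block of
`planarTransfer (Finset.Icc 0 n)` is seen by the coupling disagreement — there is `c > 0` with
`c ‖μ‖ ^ m ≤ DIS(n, m)` for all `m` (the monotone grand-coupling lower bound;
[LevinPeresWilmer2009 §12.2, §5]). -/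
theorem stub_relaxationLower :
    ∀ n : ℕ, 1 ≤ n → ∀ (μ : ℂ) (v : PlanarRowState (Finset.Icc (0 : ℤ) n) → ℂ),
      (v ≠ 0 ∧ (∀ p, (∃ x, p.1.JoinedToStar x) → v p = 0) ∧
        ∀ p, (∀ x, ¬ p.1.JoinedToStar x) →
          ∑ q, (planarTransfer (Finset.Icc (0 : ℤ) n) p q : ℂ) * v q = μ * v p) → μ ≠ 1 →
      ∃ c : ℝ, 0 < c ∧ ∀ m : ℕ,
        c * ‖μ‖ ^ m ≤
          ((((Fintype.piFinset fun _ : Fin m =>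
              (Finset.univ : Finset (Finset (Finset.Icc (0 : ℤ) n))) ×ˢ (hEdges (Finset.Icc (0 : ℤ) n)).powerset).filter
            fun seq =>
              (List.ofFn seq).foldl (fun r OH => planarRowStep OH.1 OH.2 r)
                  (planarRowStep Finset.univ (hEdges (Finset.Icc (0 : ℤ) n))
                    ⟨RowState.free (Finset.Icc (0 : ℤ) n), RowState.isPlanar_free (Finset.Icc (0 : ℤ) n)⟩) ≠
                (List.ofFn seq).foldl (fun r OH => planarRowStep OH.1 OH.2 r)
                  ⟨RowState.free (Finset.Icc (0 : ℤ) n), RowState.isPlanar_free (Finset.Icc (0 : ℤ) n)⟩).card : ℝ) /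
          ((2 : ℝ) ^ (Finset.Icc (0 : ℤ) n).card * 2 ^ (hEdges (Finset.Icc (0 : ℤ) n)).card) ^ m) := by
  intro n _hn μ v hv hμ
  obtain ⟨hv0, hvm, heig⟩ := hv
  -- two unmarked patterns with different `v`-values (`μ ≠ 1`: `v` is not constant on the block)
  obtain ⟨a, b, ha, hb, hab⟩ : ∃ a b : PlanarRowState (Finset.Icc (0 : ℤ) n),
      (∀ x, ¬ a.1.JoinedToStar x) ∧ (∀ x, ¬ b.1.JoinedToStar x) ∧ v a ≠ v b := by
    by_contra hcon
    push Not at hcon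
    obtain ⟨p, hp⟩ : ∃ p, v p ≠ 0 := by
      by_contra h
      push Not at h
      exact hv0 (funext h)
    have hpu : ∀ x, ¬ p.1.JoinedToStar x := fun x hx => hp (hvm p ⟨x, hx⟩)
    have h1 := heig p hpu
    rw [s2b_sum_planarTransfer_mul, Finset.sum_congr rfl fun OH _ =>
      hcon _ _ (s1_rowStep_not_joinedToStar OH.1 OH.2 p.1 hpu) hpu, Finset.sum_const,
      nsmul_eq_mul] at h1
    have hcard : ((((Finset.univ : Finset (Finset (Finset.Icc (0 : ℤ) n))) ×ˢ
        (hEdges (Finset.Icc (0 : ℤ) n)).powerset).card : ℕ) : ℂ) =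
        (2 : ℂ) ^ (Finset.Icc (0 : ℤ) n).card * 2 ^ (hEdges (Finset.Icc (0 : ℤ) n)).card := by
      exact_mod_cast card_univ_product_powerset (Finset.Icc (0 : ℤ) n)
    have hN : ((2 : ℂ) ^ (Finset.Icc (0 : ℤ) n).card * 2 ^ (hEdges (Finset.Icc (0 : ℤ) n)).card) ≠ 0 :=
      mul_ne_zero (pow_ne_zero _ two_ne_zero) (pow_ne_zero _ two_ne_zero)
    rw [hcard, mul_div_cancel_left₀ _ hN] at h1
    exact hμ (mul_right_cancel₀ hp (by rw [one_mul]; exact h1)).symm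
  -- constants
  have hM : ∀ q, ‖v q‖ ≤ ∑ q, ‖v q‖ := fun q =>
    Finset.single_le_sum (f := fun q => ‖v q‖) (fun q _ => norm_nonneg _) (Finset.mem_univ q)
  have hab' : 0 < ‖v a - v b‖ := norm_pos_iff.2 (sub_ne_zero.2 hab)
  have hM2 : ‖v a - v b‖ ≤ 2 * ∑ q, ‖v q‖ := (norm_sub_le _ _).trans (by linarith [hM a, hM b])
  have hMpos : 0 < 2 * ∑ q, ‖v q‖ := lt_of_lt_of_le hab' hM2
  have hNr : 0 < (2 : ℝ) ^ (Finset.Icc (0 : ℤ) n).card * 2 ^ (hEdges (Finset.Icc (0 : ℤ) n)).card := by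
    positivity
  refine ⟨‖v a - v b‖ / (2 * ∑ q, ‖v q‖), div_pos hab' hMpos, fun m => ?_⟩
  rw [le_div_iff₀ (pow_pos hNr m)]
  have key := s2b_coupling_bound (Finset.Icc (0 : ℤ) n) μ v heig
    ⟨RowState.free (Finset.Icc (0 : ℤ) n), RowState.isPlanar_free (Finset.Icc (0 : ℤ) n)⟩
    (planarRowStep Finset.univ (hEdges (Finset.Icc (0 : ℤ) n))
      ⟨RowState.free (Finset.Icc (0 : ℤ) n), RowState.isPlanar_free (Finset.Icc (0 : ℤ) n)⟩)
    a b ha hb bot_le (s2b_rel_le_alljoined n a ha) bot_le (s2b_rel_le_alljoined n b hb) m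
  rw [← div_le_iff₀' hMpos] at key
  refine le_trans (le_of_eq ?_) key
  ring
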